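import Summits.BirchSwinnertonDyer.BirchSwinnertonDyer.Theorems.RamifiedHeegnerPairLeafPartnerOrdersLeafCoordinateInputs
import Summits.BirchSwinnertonDyer.BirchSwinnertonDyer.Theorems.RamifiedHeegnerPairLeafPartnerOrdersHeckeEigenvalues
import Literature.NumberTheory.Automorphic.BrandtEichlerLevelUOperatorsCommute
import HarnessLib

/-!
# Route `RamifiedHeegnerPair`, crux U₁ `LeafRankOneUpperAtThree` (stmt-BirchSwinnertonDyer-26022), line `partnerdescent` —
# partner kernel, base change (α) part 11: (G3♭ᶜ) from THREE SELF-CONTAINED TYPED INPUTS over the CANONICAL full Hecke algebra `𝕋_{pM,d}(S)`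

HONEST FRAMING. Theorems only; helper file (`--supports stmt-BirchSwinnertonDyer-26022 --as helper`); composes ‹…BrandtCoordinateRun› (p814226),
‹…HeckeEigenvalues› and the tree's FULL HECKE ALGEBRA of a Brandt setup (‹BrandtEichlerLevelUOperators› `XiSetup.heckeAt`,
`XiSetup.fullHeckeAlgebra`; ‹…Commute› `XiSetup.heckeAt_comm`; ‹…AwayFromLevel›/`heckeAt_of_not_dvd`); no new number theory, no named fact,
no `sorry`; nothing booked; BSD is proved for no curve. Lead prover bsd-line-rhp-p2 g64, 2026-08-31.

WHY. The stub COORD-INPUTS (`Partnerdescent.LeafBrandtCoordinateInputsAtThree`, skeleton v9) is ONE conjunction because its five print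
inputs share data (the generators `G`, the twist, the eigenvalues `λ`, the lattice `Y`, `π^*`, `π_*`). Fixing the generators CANONICALLY as
the tree's `S.heckeAt q` (`q` prime) — `U_ℓ` at `ℓ ∣ pM`, `T_q` otherwise, generating `S.fullHeckeAlgebra = 𝕋_{pM,d}(S)` — and the
eigenvalues by ‹HeckeEigenvalues›, the inputs DECOUPLE into THREE self-contained statements, each over the tree's vocabulary and the canonical
degree-zero lattice (quantified as «every `B` with `v ∈ B ↔ Σ v = 0`»):
* (HT) **Hecke–Atkin–Lehner twist** — an integral `W₁` with inverse `W₂`, both degree-preserving, `W₁ T_q = T_q W₁` at the good primes,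
  and `(heckeAt q)ᵀ·(D_w W₁) = (D_w W₁)·(heckeAt q)` for every prime `q` (Gross's pairing twisted by the Atkin–Lehner involution makes the
  full Hecke algebra self-adjoint: Mazur 1977 II §15; for the `T_q` it is weight symmetry + commutation, tree); plus «every `heckeAt q`
  preserves degree zero» (column sums; tree for `T_q`, print for `U_ℓ`). [W. Zhang 2014 §3.9; Gross 1987 §1–2; Ribet 1990 §3]
* (DICT) **the character-group dictionary of `X_p(J₀^{pd}(M)) ↪ X_d(J_0(dpM))` with its Hecke structure** — `hDictDisc` of
  ‹ShimuraCurveRibetTakahashiBrandtDictionaryProofs› (Takahashi 2001 Prop. 3.1 ∕ Thm. 3.2 (a), Ribet 1990 Thm. 4.1) PLUS `Y ≤ B`, stability under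
  every `heckeAt q`, (C2′) the new-projector `u_Y ∈ 𝕋_{pM,d}(S)` (`u_Y|_Y = N₀ ≠ 0`, `u_Y B ⊆ Y`; Jacquet–Langlands + Deligne's bound) and (C5′)
  «`δ·(C y) = a·π_*(y)·π^*1` on `Y` for `C ∈ 𝕋_{pM,d}(S)` ⟹ `δ ∣ a`» (Papikian–Rabinoff ¶23 + Lemma 24).
* (M1) **multiplicity one in cosocle form** for `𝕋_{pM,d}(S)` acting on `B = X_d(J_0(dpM))` at `𝔪 = (3, heckeAt q − λ_q)`, for EVERY eigenvalue
  function `λ` of the `heckeAt q` on the `a(W′)`-line (unique; Mazur's principle: DDT 1995 Thm. 4.26 (a) = Ribet 1990 Thm. 5.2 (b) for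
  `J_0(dpM)[𝔪]`, and `Frob_d` non-scalar on the `d`-toric part; Helm 2007 Def. 6.4 ∕ Lemma 6.5).
`cokernelFifth_of_canonicalInputs`: (HT) ∧ (DICT) ∧ (M1) ⟹ the stub (G3♭ᶜ) `CokernelFifthInCoordinatesAtThree` UNFOLDED VERBATIM. Discharged here:
commutativity of the generators (`XiSetup.heckeAt_comm`), `T_q ∈` generators at good `q` (`heckeAt_of_not_dvd`), the eigenvalue function
(`exists_eigenvalues_of_forall_commute`), the canonical `B`, `ℤ[{heckeAt q}] = S.fullHeckeAlgebra` (definitional).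
[cite: WZhang2014, §3.9 p. 214] [cite: Takahashi2001, Prop. 3.1, Thm. 3.2 (a)] [cite: Ribet1990, Thm. 4.1, Thm. 5.2 (b)]
[cite: DarmonDiamondTaylor1995, Thm. 4.26 (a)] [cite: Helm2007, Def. 6.4, Lemma 6.5] [cite: PapikianRabinoff2016, §3 ¶23, Lemma 24] [cite: Mazur1977, II §15]
-/

set_option linter.dupNamespace false
set_option autoImplicit false

noncomputable section

open scoped Pointwise

namespace Summit.BirchSwinnertonDyer.BirchSwinnertonDyer.Theorems.LeafPartnerOrders

open Matrix
open Literature.NumberTheory.Automorphic Literature.NumberTheory.Automorphic.Brandt Literature.NumberTheory.EllipticCurves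
open Literature.NumberTheory.EllipticCurves.Takahashi2001 (exists_eq_span_of_finrank_eq_one)

open scoped Classical in
/-- **(G3♭ᶜ) from the three canonical typed inputs (HT), (DICT), (M1)** (see the module docstring). The conclusion is
`Partnerdescent.CokernelFifthInCoordinatesAtThree` unfolded verbatim. [cite: Takahashi2001, Thm. 2.3, Thm. 3.2 (a)]
[cite: PapikianRabinoff2016, §3 ¶23–¶25, Lemma 24, Lemma 32] [cite: DarmonDiamondTaylor1995, Thm. 4.26 (a)] -/
theorem cokernelFifth_of_canonicalInputs
    (hHT : ∀ {N D M p d : ℕ}, p.Prime → D = p * d → IsAdmissibleFactorization N D M →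
      ∀ (X : ShimuraCurveData D M) (W : WeierstrassCurve ℚ) [W.IsElliptic] [W.IsGloballyMinimal],
        W.conductorNorm ℤ = N → ¬ 3 ∣ N → W.HasIrreducibleModPGaloisRep 3 →
      ∀ [Fact d.Prime], d ≠ p → W.HasSplitMultiplicativeReductionAtPrime d →
      ∀ (S : Brandt.XiSetup (p * M) d) [Fintype (ClassSet S.O)] [DecidableEq (ClassSet S.O)],
      ∃ (W₁ W₂ : Matrix (ClassSet S.O) (ClassSet S.O) ℤ),
        W₁ * W₂ = 1 ∧ W₂ * W₁ = 1 ∧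
        (∀ v : ClassSet S.O → ℤ, ∑ c, v c = 0 → ∑ c, (W₁ *ᵥ v) c = 0) ∧
        (∀ v : ClassSet S.O → ℤ, ∑ c, v c = 0 → ∑ c, (W₂ *ᵥ v) c = 0) ∧
        (∀ q : ℕ, q.Prime → ¬ q ∣ p * M * d → W₁ * Brandt.matrix S.O q = Brandt.matrix S.O q * W₁) ∧
        (∀ q : ℕ, q.Prime → (S.heckeAt q)ᵀ * (Matrix.diagonal (fun c ↦ (weight S.O c : ℤ)) * W₁) =
          (Matrix.diagonal (fun c ↦ (weight S.O c : ℤ)) * W₁) * S.heckeAt q) ∧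
        (∀ q : ℕ, q.Prime → ∀ v : ClassSet S.O → ℤ, ∑ c, v c = 0 → ∑ c, (S.heckeAt q *ᵥ v) c = 0))
    (hDICT : ∀ {N D M p d : ℕ}, p.Prime → D = p * d → IsAdmissibleFactorization N D M →
      ∀ (X : ShimuraCurveData D M) (W : WeierstrassCurve ℚ) [W.IsElliptic] [W.IsGloballyMinimal],
        W.conductorNorm ℤ = N → ¬ 3 ∣ N → W.HasIrreducibleModPGaloisRep 3 →
      ∀ [Fact d.Prime], d ≠ p → W.HasSplitMultiplicativeReductionAtPrime d →
      ∀ (W' : WeierstrassCurve ℚ) [W'.IsElliptic] (P : ShimuraParametrizationData X W'), P.IsMinimalFor W →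
      ∀ (S : Brandt.XiSetup (p * M) d) [Fintype (ClassSet S.O)] [DecidableEq (ClassSet S.O)]
        (B : Submodule ℤ (ClassSet S.O → ℤ)), (∀ v, v ∈ B ↔ ∑ c, v c = 0) →
      ∃ (Y : Submodule ℤ (ClassSet S.O → ℤ)) (pb : ℤ →ₗ[ℤ] Y) (pf : Y →ₗ[ℤ] ℤ)
        (uY : Matrix (ClassSet S.O) (ClassSet S.O) ℤ) (N₀ : ℤ),
        (∀ (a : ℤ) (y : Y), ∑ k, (weight S.O k : ℤ) * (pb a : ClassSet S.O → ℤ) k * (y : ClassSet S.O → ℤ) k =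
          ((W'.minimalDiscriminantNorm ℤ).factorization p : ℤ) * a * pf y) ∧
        (∀ a : ℤ, pf (pb a) = (P.deg : ℤ) * a) ∧ Function.Surjective pf ∧
        (∀ (k : ℤ) (v : ClassSet S.O → ℤ), k ≠ 0 → k • v ∈ Y → v ∈ Y) ∧
        Module.finrank ℤ (eigenLattice (p * M * d) (Brandt.matrix S.O) (fun n ↦ W'.LFunction n)) = 1 ∧
        (pb 1 : ClassSet S.O → ℤ) ∈ eigenLattice (p * M * d) (Brandt.matrix S.O) (fun n ↦ W'.LFunction n) ∧
        Y ≤ B ∧ (∀ q : ℕ, q.Prime → ∀ y ∈ Y, S.heckeAt q *ᵥ y ∈ Y) ∧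
        uY ∈ S.fullHeckeAlgebra ∧ N₀ ≠ 0 ∧ (∀ y ∈ Y, uY *ᵥ y = N₀ • y) ∧ (∀ b ∈ B, uY *ᵥ b ∈ Y) ∧
        (∀ C ∈ S.fullHeckeAlgebra, ∀ a : ℤ,
          (∀ y (hy : y ∈ Y), (P.deg : ℤ) • (C *ᵥ y) = a • pf ⟨y, hy⟩ • (pb 1 : ClassSet S.O → ℤ)) → (P.deg : ℤ) ∣ a))
    (hM1 : ∀ {N D M p d : ℕ}, p.Prime → D = p * d → IsAdmissibleFactorization N D M →
      ∀ (X : ShimuraCurveData D M) (W : WeierstrassCurve ℚ) [W.IsElliptic] [W.IsGloballyMinimal],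
        W.conductorNorm ℤ = N → ¬ 3 ∣ N → W.HasIrreducibleModPGaloisRep 3 →
      ∀ [Fact d.Prime], d ≠ p → W.HasSplitMultiplicativeReductionAtPrime d →
        Nat.card (AddSubgroup.torsionBy ((W.baseChange ℚ_[d]).toAffine.Point) 3) ≠ 9 →
      ∀ (W' : WeierstrassCurve ℚ) [W'.IsElliptic] (P : ShimuraParametrizationData X W'), P.IsMinimalFor W →
      ∀ (S : Brandt.XiSetup (p * M) d) [Fintype (ClassSet S.O)] [DecidableEq (ClassSet S.O)]
        (B : Submodule ℤ (ClassSet S.O → ℤ)), (∀ v, v ∈ B ↔ ∑ c, v c = 0) →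
      ∀ (lamq : ℕ → ℤ), (∀ q : ℕ, q.Prime →
          ∀ v ∈ eigenLattice (p * M * d) (Brandt.matrix S.O) (fun n ↦ W'.LFunction n), S.heckeAt q *ᵥ v = lamq q • v) →
      ∃ x₀ ∈ B, ∀ x ∈ B, ∃ C ∈ S.fullHeckeAlgebra, x - C *ᵥ x₀ ∈
        (3 : ℤ) • B ⊔ ⨆ (q : ℕ) (_ : q.Prime),
          B.map (Matrix.mulVecLin (S.heckeAt q - lamq q • (1 : Matrix (ClassSet S.O) (ClassSet S.O) ℤ)))) :
    ∀ {N D M p d : ℕ}, p.Prime → D = p * d → IsAdmissibleFactorization N D M →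
      ∀ (X : ShimuraCurveData D M) (W : WeierstrassCurve ℚ) [W.IsElliptic] [W.IsGloballyMinimal],
        W.conductorNorm ℤ = N → ¬ 3 ∣ N → W.HasIrreducibleModPGaloisRep 3 →
      ∀ [Fact d.Prime], d ≠ p → W.HasSplitMultiplicativeReductionAtPrime d →
        Nat.card (AddSubgroup.torsionBy ((W.baseChange ℚ_[d]).toAffine.Point) 3) ≠ 9 →
      ∀ (W' : WeierstrassCurve ℚ) [W'.IsElliptic] (P : ShimuraParametrizationData X W'), P.IsMinimalFor W →
      ∀ (S : Brandt.XiSetup (p * M) d) (i j : ℕ), 0 < i →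
        i * j = (W'.minimalDiscriminantNorm ℤ).factorization p →
        P.deg * i = S.xi (fun n => W'.LFunction n) * j → ¬ 3 ∣ j := by
  intro N D M p d hp hD hadm X W _ _ hN h3 hirr _ hdp hsplit hcard W' _ P hP S i j hi hij hδi
  letI : Fintype (ClassSet S.O) := Fintype.ofFinite _
  -- the canonical degree-zero lattice and the canonical generators
  let B : Submodule ℤ (ClassSet S.O → ℤ) := LinearMap.ker (∑ c : ClassSet S.O, (LinearMap.proj c : (ClassSet S.O → ℤ) →ₗ[ℤ] ℤ))
  have hB : ∀ v : ClassSet S.O → ℤ, v ∈ B ↔ ∑ c, v c = 0 := fun v ↦ by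
    simp only [B, LinearMap.mem_ker, LinearMap.sum_apply, LinearMap.proj_apply]
  let G : Set (Matrix (ClassSet S.O) (ClassSet S.O) ℤ) := {X₁ | ∃ q : ℕ, q.Prime ∧ X₁ = S.heckeAt q}
  have hGA : Algebra.adjoin ℤ G = S.fullHeckeAlgebra := rfl
  have hGmem : ∀ q : ℕ, q.Prime → S.heckeAt q ∈ G := fun q hq ↦ ⟨q, hq, rfl⟩
  have hGcomm : ∀ X₁ ∈ G, ∀ X₂ ∈ G, X₁ * X₂ = X₂ * X₁ := by
    rintro _ ⟨q, hq, rfl⟩ _ ⟨q', hq', rfl⟩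
    exact S.heckeAt_comm hq hq'
  have hNpl : ∀ q : ℕ, ¬ q ∣ p * M * d → ¬ q ∣ p * M := fun q hq h ↦ hq (Dvd.dvd.mul_right h d)
  have hGan : ∀ q : ℕ, q.Prime → ¬ q ∣ p * M * d → Brandt.matrix S.O q ∈ G := by
    intro q hq hqN
    rw [← S.heckeAt_of_not_dvd (hNpl q hqN)]
    exact hGmem q hq
  -- the three inputs at these binders
  obtain ⟨W₁, W₂, hWW', hW'W, hWdeg, hW'deg, hWT, hadj, hdeg⟩ := hHT hp hD hadm X W hN h3 hirr hdp hsplit S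
  obtain ⟨Y, pb, pf, uY, N₀, hadjY, hδ, hsurj, hYsat, hrank, hmem, hYB, hYG, huYG, hN₀, huY, huYB, hC5⟩ :=
    hDICT hp hD hadm X W hN h3 hirr hdp hsplit W' P hP S B hB
  -- the eigenvalues of the generators on the line
  obtain ⟨g, hg0, hL⟩ := exists_eq_span_of_finrank_eq_one hrank
  have hGT : ∀ X₁ ∈ G, ∀ q : ℕ, q.Prime → ¬ q ∣ p * M * d → X₁ * Brandt.matrix S.O q = Brandt.matrix S.O q * X₁ :=
    forall_commute_of_pairwise G hGcomm hGan
  obtain ⟨lamG, hlamG⟩ := exists_eigenvalues_of_forall_commute G hGT hL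
  obtain ⟨x₀, hx₀, hmult⟩ := hM1 hp hD hadm X W hN h3 hirr hdp hsplit hcard W' P hP S B hB (fun q ↦ lamG (S.heckeAt q))
    (fun q hq v hv ↦ hlamG _ (hGmem q hq) v hv)
  -- the `q`-indexed supremum is the `G`-indexed one
  have hsup : (⨆ (q : ℕ) (_ : q.Prime),
        B.map (Matrix.mulVecLin (S.heckeAt q - lamG (S.heckeAt q) • (1 : Matrix (ClassSet S.O) (ClassSet S.O) ℤ)))) ≤
      ⨆ X₁ ∈ G, B.map (Matrix.mulVecLin (X₁ - lamG X₁ • (1 : Matrix (ClassSet S.O) (ClassSet S.O) ℤ))) := by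
    refine iSup₂_le fun q hq ↦ ?_
    exact le_iSup₂_of_le (S.heckeAt q) (hGmem q hq) le_rfl
  have hmult' : ∀ x ∈ B, ∃ C ∈ Algebra.adjoin ℤ G, x - C *ᵥ x₀ ∈
      (3 : ℤ) • B ⊔ ⨆ X₁ ∈ G, B.map (Matrix.mulVecLin (X₁ - lamG X₁ • (1 : Matrix (ClassSet S.O) (ClassSet S.O) ℤ))) := by
    intro x hx
    obtain ⟨C, hC, hxC⟩ := hmult x hx
    exact ⟨C, hGA ▸ hC, sup_le_sup_left hsup _ hxC⟩
  -- the Mazur–Chebotarev prime and the isogeny invariance of `a_n`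
  obtain ⟨ℓ, hℓ, -, hℓN, h3ℓ⟩ := exists_prime_not_dvd_lFunction_sub_of_hasIrreducibleModPGaloisRep W 3 hirr
  have hLW : W'.LFunction = W.LFunction := (LFunction_eq_of_isIsogenous_holds W W' hP.1).symm
  have hℓN' : ¬ ℓ ∣ p * M * d := by
    rw [hN] at hℓN
    have : p * M * d = N := by rw [← hadm.mul_eq, hD]; ring
    rwa [this]
  have h3ℓ' : ¬ (3 : ℤ) ∣ (fun n ↦ W'.LFunction n) ℓ - (ℓ + 1) := by
    simp only [hLW]
    exact_mod_cast h3ℓ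
  exact not_dvd_of_brandtCoordinateInputs S (fun n ↦ W'.LFunction n) hℓ hℓN' h3ℓ' hrank B hB G hGcomm
    (fun X₁ hX₁ v hv ↦ by obtain ⟨q, hq, rfl⟩ := hX₁; exact hdeg q hq v hv) hGan W₁ W₂ hWW' hW'W hWdeg hW'deg (hWT ℓ hℓ hℓN')
    (fun X₁ hX₁ ↦ by obtain ⟨q, hq, rfl⟩ := hX₁; exact hadj q hq) lamG hlamG Y pb pf _ P.deg P.deg_pos hadjY hδ hsurj hYsat hmem hYB
    (fun X₁ hX₁ y hy ↦ by obtain ⟨q, hq, rfl⟩ := hX₁; exact hYG q hq y hy) uY (hGA ▸ huYG) N₀ hN₀ huY huYB x₀ hx₀ hmult'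
    (fun C hC a h ↦ hC5 C (hGA ▸ hC) a h) i j hi hij hδi

end Summit.BirchSwinnertonDyer.BirchSwinnertonDyer.Theorems.LeafPartnerOrders

end
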